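import Mathlib
import HarnessLib
import Summits.ValiantsHypothesis.ValiantsHypothesis.Theses.MonotoneRestoration
import Literature.Computability.AlgebraicComplexity.ArithCircuit
import Literature.Computability.AlgebraicComplexity.ArithCircuitProofs
import Literature.Computability.AlgebraicComplexity.MonotoneStructure
import Literature.Computability.AlgebraicComplexity.PermanentIrreducible
import Literature.ModelTheory.FiniteModelTheory.CkEquiv
import Summits.ValiantsHypothesis.ValiantsHypothesis.Theorems.MonotoneRestorationMonotoneRestorationQPCosetCount
import Summits.ValiantsHypothesis.ValiantsHypothesis.Theorems.MonotoneRestorationMonotoneRestorationQPSymmetricLB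
import Summits.ValiantsHypothesis.ValiantsHypothesis.Theorems.MonotoneRestorationMonotoneRestorationQPSupportSymmetrisation
import Summits.ValiantsHypothesis.ValiantsHypothesis.Theorems.MonotoneRestorationMonotoneRestorationQPSparseRegime
import Summits.ValiantsHypothesis.ValiantsHypothesis.Theorems.MonotoneRestorationMonotoneRestorationQPBeta
import Literature.Computability.AlgebraicComplexity.SymmetricArithCircuit
import Literature.Computability.AlgebraicComplexity.DawarWilsenach2025Proofs
import Literature.GroupTheory.PermutationGroups.SmallIndexSubgroups
import Summits.ValiantsHypothesis.ValiantsHypothesis.Theorems.MonotoneRestorationQP.Negative.LoadBearing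
import Summits.ValiantsHypothesis.ValiantsHypothesis.Theorems.MonotoneRestorationMonotoneRestorationQPPermSupportCount

/-! TTRL-lite variant V19041 of stmt-ValiantsHypothesis-15886

`[klein_index3]` (move `lemma_proposal`): group-level form of the `n = 4` counterexample behind the
`m = 4` threshold of `stub_altFixing_orbit_dichotomy` — `V₄ ◁ A₄` has index `3 < 4`. -/

namespace Summit.ValiantsHypothesis.ValiantsHypothesis.Theorems

open Summit.ValiantsHypothesis.ValiantsHypothesis.Theses.MonotoneRestoration
open Literature.Computability.AlgebraicComplexity

/-- TTRL-lite variant V19041 (`[klein_index3]`): the Klein four subgroup `V₄ ◁ A₄` has index `3`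
(so in particular `< 4`). This is Lagrange: `|A₄| = 12`
(`alternatingGroup.card_of_card_eq_four`), `|V₄| = 4`
(`alternatingGroup.kleinFour_card_of_card_eq_four`) and `Subgroup.card_mul_index`. -/
theorem stub_altFixing_orbit_dichotomy_var19041 :
    (alternatingGroup.kleinFour (Fin 4)).index = 3 := by
  have h4 : Nat.card (Fin 4) = 4 := by simp
  have hG : Nat.card (alternatingGroup (Fin 4)) = 12 :=
    alternatingGroup.card_of_card_eq_four h4
  have hK : Nat.card (alternatingGroup.kleinFour (Fin 4)) = 4 :=
    alternatingGroup.kleinFour_card_of_card_eq_four h4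
  have hmul := (alternatingGroup.kleinFour (Fin 4)).card_mul_index
  rw [hG, hK] at hmul
  omega

end Summit.ValiantsHypothesis.ValiantsHypothesis.Theorems
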